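import Literature.NumberTheory.EllipticCurves.PastenValuationProductEpsilonProofs
import Literature.NumberTheory.DiophantineGeometry.ConductorFactorizationProofs
import Literature.NumberTheory.DiophantineGeometry.MinimalDiscriminantFactorizationProofs
import Mathlib.Analysis.SpecialFunctions.Pow.Real
import HarnessLib

/-!
# Route PlacewiseSzpiro, crux `SingleTowerSzpiro` (stmt-ABC-22410), line `birth`:
# the crux AT THE SINGLE PRIME `2` already gives an exponential lower bound for `rad(2ⁿ − 1)`

Summits-side helper (theorems only; no definition, no named fact, no `Theses` import). The crux S1
(`stub_multiplicativeTower`: `f_v = 1 → ord_v(Δ_min(E)) · log p_v ≤ (6+ε) log N_E + C`) is tested on ONE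
explicit family at ONE place: the Mersenne Frey–Hellegouarch curves `W_n : y² = x(x + 1)(x + 2ⁿ)` of the abc
triples `1 + (2ⁿ − 1) = 2ⁿ` (`freyCurve (-1) (2^n)`, `n ≥ 5`; tree data of
`PastenValuationProductEpsilonProofs`: `N_{W_n} = 2 · rad(2ⁿ − 1)` squarefree, `Δ_min = 2^{2n−8}(2ⁿ−1)²`, so the
place `2` is multiplicative with tower `(2n − 8) · log 2`).

* **`log_radical_mersenne_ge_of_tower_two_bound`** — if the `2`-adic tower of every elliptic curve with
  multiplicative reduction at `2` satisfies `ord_2(Δ_min) · log 2 ≤ K · log N_E + C` (`K > 0`), then for every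
  `n ≥ 5`: `log rad(2ⁿ − 1) ≥ ((2n − 8) log 2 − C)/K − log 2`, i.e.
  **`rad(2ⁿ − 1) ≥ c(K, C) · 2^{2n/K}`** (`radical_mersenne_ge_of_tower_two_bound`, `c = 2^{−8/K} e^{−C/K} / 2`).
* `radical_mersenne_ge_of_singleTower` — hence the crux S1 (slope `K = 6 + ε`, spelled out) gives
  `rad(2ⁿ − 1) ≥ c(ε) · 2^{n/(3+ε)}` for every `ε > 0`; so does every LOG-SCALE restatement of the line's first
  deliverable that keeps the prime `2` (any slope `K`: exponent `2/K`).

STATUS OF THE CONCLUSION (presearch, corpus + galaxy, 2026-08-27): an exponential lower bound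
`rad(2ⁿ − 1) ≫ 2^{θn}` (any fixed `θ > 0`) is NOT KNOWN. In print: `abc ⟹ rad(2ⁿ−1) ≫_ε 2^{(1−ε)n}` and
Silverman's «abc ⟹ infinitely many non-Wieferich primes» (J. Number Theory 30 (1988); tree `IsWieferich`,
abc.S15) with its 2015–2024 descendants (arXiv:1511.05645, Ding 2019, …) — all conditional; unconditionally
Stewart–Yu gives only `rad(2ⁿ − 1) ≫ n³/(log n)⁹` (`log 2ⁿ ≤ κ R^{1/3}(log R)³`, `BakerMethodBounds`) and Stewart
(Acta Math. 211 (2013)) `P(2ⁿ − 1) > n · exp(log n /(104 log log n))` (tree `StewartPadicOrder`). So S1 — even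
restricted to the prime `2` and to this one family — is at least as hard as a classical open problem on Mersenne
numbers; this is the log-scale companion of `…FirstDeliverableCalib` (polynomial scale: FD ⟺ all-`E` Szpiro
exponent `< 1/3`) and `…FreyLargePrimes` (Frey locus: FD ⟺ beating Stewart–Yu).

HONESTY: an implication between typed statements; nothing here proves or refutes S1; no summit, rung or stub is
proved; A1′/A-PS are NOT abc; typed ≠ proved. No `def` in this file.
-/

noncomputable section

-- `Summit.<Summit>.<Problem>` is the mandated summit-side namespace (CONVENTIONS §2); for the
-- single-conjunct summit `ABC` the two coincide, so the duplicate `ABC.ABC` is deliberate.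
set_option linter.dupNamespace false

namespace Summit.ABC.ABC.Theorems.SingleTowerSzpiroLine

open IsDedekindDomain UniqueFactorizationMonoid
open Literature.NumberTheory.EllipticCurves

/-! ### The Mersenne Frey curve at the place `2` -/

/-- There is a place of `ℤ` over `2` (`Rat.HeightOneSpectrum.primesEquiv`). [folklore] -/
theorem exists_place_two : ∃ v : HeightOneSpectrum ℤ, Rat.HeightOneSpectrum.natGenerator v = 2 :=
  ⟨(Rat.HeightOneSpectrum.primesEquiv (R := ℤ)).symm ⟨2, Nat.prime_two⟩,
    congrArg Subtype.val ((Rat.HeightOneSpectrum.primesEquiv (R := ℤ)).apply_symm_apply ⟨2, Nat.prime_two⟩)⟩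

/-- `W_n = freyCurve (-1) (2^n)` has multiplicative reduction at `2` (`f_2 = 1`): its conductor
`2 · rad(2ⁿ − 1)` is squarefree and even (`n ≥ 5`). [folklore] -/
theorem conductorExponent_two_freyCurve_mersenne {n : ℕ} (hn : 5 ≤ n) (v : HeightOneSpectrum ℤ)
    (hv : Rat.HeightOneSpectrum.natGenerator v = 2) :
    (freyCurve (-1) (2 ^ n)).conductorExponent v = 1 := by
  haveI := isElliptic_freyCurve_mersenne (n := n) (by omega)
  have hf := (freyCurve (-1) (2 ^ n)).factorization_conductorNorm_holds v
  rw [hv] at hf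
  rw [← hf]
  have hsq := squarefree_conductorNorm_freyCurve_mersenne hn
  have hle := hsq.natFactorization_le_one 2
  have hdvd : 2 ∣ (freyCurve (-1) (2 ^ n)).conductorNorm ℤ := by
    rw [conductorNorm_freyCurve_mersenne_eq hn]; exact dvd_mul_right 2 _
  have hpos := Nat.prime_two.factorization_pos_of_dvd hsq.ne_zero hdvd
  omega

/-- The `2`-adic tower of `W_n`: `ord_2(Δ_min(W_n)) = 2n − 8` (`n ≥ 5`). [folklore] -/
theorem ordMinimalDiscriminant_two_freyCurve_mersenne {n : ℕ} (hn : 5 ≤ n) (v : HeightOneSpectrum ℤ)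
    (hv : Rat.HeightOneSpectrum.natGenerator v = 2) :
    (freyCurve (-1) (2 ^ n)).ordMinimalDiscriminant v = 2 * n - 8 := by
  have h := WeierstrassCurve.factorization_minimalDiscriminantNorm_holds (freyCurve (-1) (2 ^ n)) v
  rw [hv, factorization_two_minimalDiscriminantNorm_freyCurve_mersenne hn] at h
  exact h.symm

/-! ### From a `2`-adic tower bound to the radical of Mersenne numbers -/

/-- **A `2`-adic single-tower bound with slope `K` forces `log rad(2ⁿ − 1) ≥ ((2n−8) log 2 − C)/K − log 2`.**
Hypothesis (the crux S1 restricted to the prime `2`, with a free slope `K > 0`): for every elliptic `E/ℚ` with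
multiplicative reduction at `2`, `ord_2(Δ_min(E)) · log 2 ≤ K · log N_E + C`. Applied to
`W_n : y² = x(x+1)(x+2ⁿ)` (`N = 2 rad(2ⁿ−1)`, tower `(2n−8) log 2`). [folklore] -/
theorem log_radical_mersenne_ge_of_tower_two_bound {K C : ℝ} (hK : 0 < K)
    (h : ∀ (W : WeierstrassCurve ℚ) [W.IsElliptic] (v : HeightOneSpectrum ℤ),
      Rat.HeightOneSpectrum.natGenerator v = 2 → W.conductorExponent v = 1 →
        (W.ordMinimalDiscriminant v : ℝ) * Real.log (Rat.HeightOneSpectrum.natGenerator v : ℝ) ≤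
          K * Real.log (W.conductorNorm ℤ : ℝ) + C)
    {n : ℕ} (hn : 5 ≤ n) :
    ((2 * (n : ℝ) - 8) * Real.log 2 - C) / K - Real.log 2 ≤ Real.log ((radical (mersenne n) : ℕ) : ℝ) := by
  haveI := isElliptic_freyCurve_mersenne (n := n) (by omega)
  obtain ⟨v, hv⟩ := exists_place_two
  have h1 := h (freyCurve (-1) (2 ^ n)) v hv (conductorExponent_two_freyCurve_mersenne hn v hv)
  rw [ordMinimalDiscriminant_two_freyCurve_mersenne hn v hv, hv,
    conductorNorm_freyCurve_mersenne_eq hn] at h1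
  have hrad0 : 0 < radical (mersenne n) := Nat.radical_pos _
  have hrad : (0 : ℝ) < ((radical (mersenne n) : ℕ) : ℝ) := by exact_mod_cast hrad0
  have hcast : ((2 * n - 8 : ℕ) : ℝ) = 2 * (n : ℝ) - 8 := by
    rw [Nat.cast_sub (by omega)]; push_cast; ring
  rw [hcast] at h1
  push_cast at h1
  rw [Real.log_mul two_ne_zero hrad.ne'] at h1
  -- `(2n−8) log 2 ≤ K (log 2 + log rad) + C`
  rw [div_sub' (ne_of_gt hK), div_le_iff₀ hK]
  nlinarith

/-- **Exponential form: `rad(2ⁿ − 1) ≥ c · 2^{(2/K) n}`** with `c = exp(−(8 log 2 + C)/K − log 2) > 0`, under the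
same `2`-adic single-tower hypothesis with slope `K > 0`. No `θ > 0` with `rad(2ⁿ − 1) ≫ 2^{θ n}` is known
unconditionally (see the module docstring). [folklore] -/
theorem radical_mersenne_ge_of_tower_two_bound {K C : ℝ} (hK : 0 < K)
    (h : ∀ (W : WeierstrassCurve ℚ) [W.IsElliptic] (v : HeightOneSpectrum ℤ),
      Rat.HeightOneSpectrum.natGenerator v = 2 → W.conductorExponent v = 1 →
        (W.ordMinimalDiscriminant v : ℝ) * Real.log (Rat.HeightOneSpectrum.natGenerator v : ℝ) ≤
          K * Real.log (W.conductorNorm ℤ : ℝ) + C) :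
    ∃ c : ℝ, 0 < c ∧ ∀ n : ℕ, 5 ≤ n →
      c * (2 : ℝ) ^ ((2 / K) * n) ≤ ((radical (mersenne n) : ℕ) : ℝ) := by
  refine ⟨Real.exp (-(8 * Real.log 2 + C) / K - Real.log 2), Real.exp_pos _, fun n hn => ?_⟩
  have h1 := log_radical_mersenne_ge_of_tower_two_bound hK h hn
  have hrad : (0 : ℝ) < ((radical (mersenne n) : ℕ) : ℝ) := by exact_mod_cast Nat.radical_pos _
  -- exponentiate: `exp(lhs) ≤ rad`
  have h2 : Real.exp (((2 * (n : ℝ) - 8) * Real.log 2 - C) / K - Real.log 2) ≤ ((radical (mersenne n) : ℕ) : ℝ) := by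
    rw [← Real.exp_log hrad]; exact Real.exp_le_exp.mpr h1
  have hsplit : ((2 * (n : ℝ) - 8) * Real.log 2 - C) / K - Real.log 2 =
      (-(8 * Real.log 2 + C) / K - Real.log 2) + Real.log 2 * (2 / K * n) := by
    field_simp; ring
  have e2 : Real.exp (Real.log 2 * (2 / K * (n : ℝ))) = (2 : ℝ) ^ (2 / K * (n : ℝ)) := by
    rw [Real.rpow_def_of_pos two_pos]
  rw [hsplit, Real.exp_add, e2] at h2
  exact h2

/-- **The crux S1 ⟹ `rad(2ⁿ − 1) ≥ c(ε) · 2^{n/(3+ε)}`** (S1 = `stub_multiplicativeTower` spelled out verbatim;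
only its instance at the prime `2` on the Mersenne Frey curves is used; `2/(6+2ε) = 1/(3+ε)`). The conclusion is
an open problem for every exponent `> 0`; abc would give exponent `1 − ε`. [folklore] -/
theorem radical_mersenne_ge_of_singleTower
    (hS1 : ∀ ε : ℝ, 0 < ε → ∃ C : ℝ, ∀ (W : WeierstrassCurve ℚ) [W.IsElliptic] (v : HeightOneSpectrum ℤ),
      W.conductorExponent v = 1 →
        (W.ordMinimalDiscriminant v : ℝ) * Real.log (Rat.HeightOneSpectrum.natGenerator v : ℝ) ≤
          (6 + ε) * Real.log (W.conductorNorm ℤ : ℝ) + C)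
    {ε : ℝ} (hε : 0 < ε) :
    ∃ c : ℝ, 0 < c ∧ ∀ n : ℕ, 5 ≤ n →
      c * (2 : ℝ) ^ ((1 / (3 + ε)) * n) ≤ ((radical (mersenne n) : ℕ) : ℝ) := by
  obtain ⟨C, hC⟩ := hS1 (2 * ε) (by linarith)
  have hK : (0 : ℝ) < 6 + 2 * ε := by linarith
  obtain ⟨c, hc0, hc⟩ := radical_mersenne_ge_of_tower_two_bound hK (C := C)
    (fun W _ v _ hf => hC W v hf)
  refine ⟨c, hc0, fun n hn => ?_⟩
  have hexp : 2 / (6 + 2 * ε) = 1 / (3 + ε) := by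
    field_simp; ring
  have h := hc n hn
  rwa [hexp] at h

end Summit.ABC.ABC.Theorems.SingleTowerSzpiroLine

end
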